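import Summits.KontsevichZagierPeriods.KontsevichZagierPeriods.Theorems.RootDecompWalshStrataPiBSector
import Summits.KontsevichZagierPeriods.KontsevichZagierPeriods.Theorems.RootDecompWalshStrataCutBall4Chart
import Summits.KontsevichZagierPeriods.KontsevichZagierPeriods.Theorems.RootDecompWalshStrataCutBall4Pieces
import Summits.KontsevichZagierPeriods.KontsevichZagierPeriods.Theorems.RootDecompWalshStrataEtypeClosed

/-!
# Root decomposition on Walsh strata — part 107 (gen 13): the face-cut 4-ball descends to `[hq]·B`

Crux `QuadricSignKernel` (item 25393), slice `d = 4`.  THE SPECIMEN of generation 13: for every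
rational `ρ ≤ 2` and weight `q`, the standard cell `[C_ρ, q]` of the face-cut ball
`cutPoly ρ = ρ − Σ Xᵢ²` is `InPiBaker` — congruent INSIDE the three Kontsevich–Zagier rules to
`[hq,1]·y` with `y` in the Baker sector (`inPiBaker_cutBall`).  Its value
`q·(vol B₊(√ρ) − 4·vol K(ρ))` carries `π²`, `π·arctan √(ρ−1)`-type and `π·√·` terms: the first
`d = 4` quadric cells outside the `π`-polynomial sector `Π` of gen 12, now decided.  The chain:

1. `tRep = [T(ρ), q·g]` is `InBaker`: it is the rule-(3) length representation of the 3-dimensional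
   constant-weight band `0 < t < g(y, y₁)` over `T(ρ)`, which is the standard cell of the quadric
   `p3 ρ = ρ − (1 + X₀)² − X₁² − X₂` of dimension `3` up to the null face `{y = 0}`; dimension `3` is
   the PROVED support `QuadricBakerDescent` (`quadricBakerDescent_holds`, part 64).
2. the unit quarter disc is `[hq,1]` (parts 80, 94), so the chart source `tRep × disc` is `InPiBaker`
   (products preserve relations, `KZ.of_mul_mem_relations`), hence so is the cap `[K_0(ρ), q]`
   (part 105), every cap `[K_i(ρ), q]` (swap), the orthant ball `[B_0(ρ), q] ≡ [unit cell, ρ²q]`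
   (dilation; `InPiBaker.of_ball4_cell`, parts 95/103), and by peeling the four caps (rule (1a),
   part 106) the face-cut ball `[C_ρ, q] = [B_4(ρ), q]`.

Consequences: `cutPoly ρ` (`ρ ≤ 2`) and its permuted reflections are in the `[hq]·B`-class, so every
vanishing `ℤ`-combination of such cells (unit balls included, `ρ = 1`) is a Kontsevich–Zagier relation
UNCONDITIONALLY (`sum_mem_relations_cutBalls`, kernel `PiB.piBKernel`); mixed with paraboloids, cones
and all quadric cells of dimension `≤ 3` they lie in the affine-`π` class `A = B + [hq]·B`, where the one
typed oracle is `PiB.AffinePiKernel` (`sum_mem_relations_aff_inventory`).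
[KontsevichZagier2001 §1.2, §4.1; Baker1975 Thm 2.1; BCR1998 §2.1]
-/

noncomputable section

open Literature.NumberTheory.Transcendental
open MeasureTheory Set
open MvPolynomial (aeval X C rename bind₁)
open Literature.ModelTheory.ExponentialFields (IsSemialgebraic isSemialgebraic_setOf_eval_pos
  isSemialgebraic_setOf_eval_eq_zero)
open Summit.KontsevichZagierPeriods.RootDecompWalshStrata.WalshSpanProof (cellRep cellRep_domain
  cellRep_integrand)
open Summit.KontsevichZagierPeriods.RootDecompWalshStrata.ConeSpecimen (discPoly)
open Summit.KontsevichZagierPeriods.RootDecompWalshStrata.ConicDescent (InBaker bakerSector bandRep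
  bandRep_domain bandRep_integrand oband mem_oband of_bandRep_sub_of_lenRep_mem_relations)
open Summit.KontsevichZagierPeriods.RootDecompWalshStrata.ConicDescent.BallCube (quadricBakerDescent_holds)
open Summit.KontsevichZagierPeriods.RootDecompWalshStrata.Ball4 (ball4Poly of_disc_sub_of_arcRep_mem_relations)
open Summit.KontsevichZagierPeriods.RootDecompWalshStrata.Parab4 (parab4Poly)
open Summit.KontsevichZagierPeriods.RootDecompWalshStrata.Cone4 (cone4Poly)
open Summit.KontsevichZagierPeriods.RootDecompWalshStrata.BakerAt (quadricBakerDescent_iff)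
open Summit.KontsevichZagierPeriods.RootDecompWalshStrata.DecompTwo (bakerGens)
open Summit.KontsevichZagierPeriods.RootDecompWalshStrata.PiSector (hqRep of_arcRep_sub_of_hqRep_mem_relations)
open Summit.KontsevichZagierPeriods.RootDecompWalshStrata.PiAt (QuadricDescentAt bakerDescentAt_iff
  descentAt_rename descentAt_rename_reflect piDescentAt_parab4 piDescentAt_cone4)
open Summit.KontsevichZagierPeriods.RootDecompWalshStrata.PiB (InPiBaker piBGens affGens AffinePiKernel
  piBDescentAt_of_inPiBaker sum_mem_relations_piB sum_mem_relations_aff affDescentAt_of_piBDescentAt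
  affDescentAt_of_piDescentAt affDescentAt_of_bakerDescentAt)

namespace Summit.KontsevichZagierPeriods.RootDecompWalshStrata.CutBall4

variable {ρ : ℚ}

/-! #### 0. Congruence helpers -/

/-- `InBaker` along a relation `x − x'`. [this node] -/
theorem inBaker_congr' {x x' : KZ.FormalRep} (hx : InBaker x) (h : x - x' ∈ KZ.relations) :
    InBaker x' :=
  hx.congr (by rw [← neg_sub]; exact neg_mem h)

/-- `InPiBaker` along a relation `x − x'`. [this node] -/
theorem inPiBaker_congr' {x x' : KZ.FormalRep} (hx : InPiBaker x) (h : x - x' ∈ KZ.relations) :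
    InPiBaker x' :=
  hx.congr (by rw [← neg_sub]; exact neg_mem h)

/-! #### 1. The planar factor `tRep` is in the Baker sector -/

/-- The quadric `p3 ρ = ρ − (1 + X₀)² − X₁² − X₂` of dimension `3` whose standard cell is the band
`0 < t < g(y, y₁)` over `T(ρ)` (up to the null face `y = 0`). -/
def p3 (ρ : ℚ) : MvPolynomial (Fin 3) ℚ := C ρ - (1 + X 0) ^ 2 - X 1 ^ 2 - X 2

/-- Evaluation of `p3`. [definition] -/
@[simp] theorem aeval_p3 (z : Fin 3 → ℝ) :
    aeval z (p3 ρ) = (ρ : ℝ) - (1 + z 0) ^ 2 - z 1 ^ 2 - z 2 := by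
  simp [p3]

/-- `p3 ρ` is a quadric. [elementary] -/
theorem totalDegree_p3_le (ρ : ℚ) : (p3 ρ).totalDegree ≤ 2 := by
  unfold p3
  have h1 : ((1 : MvPolynomial (Fin 3) ℚ) + X 0).totalDegree ≤ 1 :=
    (MvPolynomial.totalDegree_add _ _).trans (max_le (by simp) (by simp [MvPolynomial.totalDegree_X]))
  refine (MvPolynomial.totalDegree_sub _ _).trans (max_le ?_ ?_)
  · refine (MvPolynomial.totalDegree_sub _ _).trans (max_le ?_ ?_)
    · refine (MvPolynomial.totalDegree_sub _ _).trans (max_le (by simp) ?_)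
      exact (MvPolynomial.totalDegree_pow _ _).trans (by omega)
    · simp [MvPolynomial.totalDegree_X_pow]
  · simp [MvPolynomial.totalDegree_X]

/-- Every constant-weight quadric cell of dimension `3` is `InBaker` (the PROVED support
`QuadricBakerDescent`, part 64). [KontsevichZagier2001 §1.2; Baker1975 Thm 2.1] -/
theorem inBaker_cellRep_three (P : MvPolynomial (Fin 3) ℚ) (hdeg : P.totalDegree ≤ 2) (q : ℚ) :
    InBaker (KZ.of (cellRep P q)) :=
  quadricBakerDescent_holds 3 P q (cellRep P q) ⟨cellRep_domain P q, fun x _ => cellRep_integrand P q x⟩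
    hdeg le_rfl

/-- The constant-weight band `band3 = [{(y, y₁, t) | (y, y₁) ∈ T(ρ), 0 < t < g(y, y₁)}, q]`. -/
def band3 (ρ q : ℚ) (h2 : ρ ≤ 2) : KZ.IntegralRep 3 :=
  bandRep (tSet ρ) (isSemialgebraic_tSet ρ) (tSet_subset_Icc h2) (fun _ => (0 : ℝ)) (gB ρ)
    (isSemialgebraicFunOn_zero (isSemialgebraic_tSet ρ)) (isSemialgebraicFunOn_gB (isSemialgebraic_tSet ρ))
    (fun _ _ => le_rfl) (fun _ hy => gB_le_one h2 hy) q

/-- Membership in the band, in coordinates. [definition] -/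
theorem mem_band3_iff (q : ℚ) (h2 : ρ ≤ 2) {z : Fin 3 → ℝ} :
    z ∈ (band3 ρ q h2).domain ↔
      (0 ≤ z 0 ∧ 0 < z 1 ∧ (1 + z 0) ^ 2 + z 1 ^ 2 < ρ) ∧
        0 < z 2 ∧ z 2 < (ρ : ℝ) - (1 + z 0) ^ 2 - z 1 ^ 2 :=
  Iff.rfl

/-- **Rule (3): `[band3] − [tRep] ∈ relations`** (`ConicDescent.of_bandRep_sub_of_lenRep_mem_relations`).
[KontsevichZagier2001 §1.2 rule (3)] -/
theorem of_band3_sub_of_tRep_mem_relations (q : ℚ) (h2 : ρ ≤ 2) :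
    KZ.of (band3 ρ q h2) - KZ.of (tRep ρ q h2) ∈ KZ.relations :=
  of_bandRep_sub_of_lenRep_mem_relations (tSet ρ) (isSemialgebraic_tSet ρ) (tSet_subset_Icc h2)
    (fun _ => (0 : ℝ)) (gB ρ) (isSemialgebraicFunOn_zero (isSemialgebraic_tSet ρ))
    (isSemialgebraicFunOn_gB (isSemialgebraic_tSet ρ)) (fun _ _ => le_rfl) (fun _ hy => (gB_pos hy).le)
    (fun _ hy => gB_le_one h2 hy) q

/-- The band is the standard cell of `p3 ρ` plus the null face `{y = 0}`. [elementary] -/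
theorem band3_domain_eq_union (q : ℚ) (h2 : ρ ≤ 2) :
    (band3 ρ q h2).domain =
      (cellRep (p3 ρ) q).domain ∪ ((band3 ρ q h2).domain ∩ {z | z 0 = 0}) := by
  have h2' : (ρ : ℝ) ≤ 2 := by exact_mod_cast h2
  ext z
  rw [mem_union, mem_inter_iff, mem_band3_iff, cellRep_domain, mem_setOf_eq, mem_setOf_eq, aeval_p3]
  constructor
  · rintro ⟨⟨h0, h1, hr⟩, ht, htg⟩
    rcases h0.lt_or_eq with h0' | h0'
    · have hz0 : z 0 < 1 := by nlinarith
      have hz1 : z 1 < 1 := by nlinarith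
      have hz2 : z 2 < 1 := by nlinarith [sq_nonneg (z 1)]
      refine Or.inl ⟨fun j => ?_, by linarith⟩
      fin_cases j
      · exact ⟨h0', hz0⟩
      · exact ⟨h1, hz1⟩
      · exact ⟨ht, hz2⟩
    · exact Or.inr ⟨⟨⟨h0, h1, hr⟩, ht, htg⟩, h0'.symm⟩
  · rintro (⟨hj, hP⟩ | ⟨hD, -⟩)
    · obtain ⟨h0, -⟩ := hj 0
      obtain ⟨h1, -⟩ := hj 1
      obtain ⟨ht, -⟩ := hj 2
      exact ⟨⟨h0.le, h1, by linarith⟩, ht, by linarith⟩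
    · exact hD

/-- **`band3` is `InBaker`**: split off the null face `{y = 0}` (rule (1a)); the rest is the standard
cell of the `3`-dimensional quadric `p3 ρ`. [KontsevichZagier2001 §1.2; Baker1975 Thm 2.1] -/
theorem inBaker_band3 (q : ℚ) (h2 : ρ ≤ 2) : InBaker (KZ.of (band3 ρ q h2)) := by
  have hA : IsSemialgebraic ℚ (cellRep (p3 ρ) q).domain := (cellRep (p3 ρ) q).isSemialgebraic_domain
  have hH : IsSemialgebraic ℚ {z : Fin 3 → ℝ | z 0 = 0} := by
    convert isSemialgebraic_setOf_eval_eq_zero (k := ℚ) (R := ℝ) (X 0 : MvPolynomial (Fin 3) ℚ)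
      using 1
    ext z
    simp
  have hB : IsSemialgebraic ℚ ((band3 ρ q h2).domain ∩ {z | z 0 = 0}) :=
    (band3 ρ q h2).isSemialgebraic_domain.inter hH
  have hvolH : volume {z : Fin 3 → ℝ | z 0 = 0} = 0 := by
    rw [volume_pi]
    exact Measure.pi_hyperplane _ _ _
  have hAr : (cellRep (p3 ρ) q).domain ⊆ (band3 ρ q h2).domain := by
    rw [band3_domain_eq_union q h2]; exact subset_union_left
  refine ConicDescent.InBaker.of_split (band3 ρ q h2) hA hB hAr inter_subset_left
    (band3_domain_eq_union q h2) (measure_mono_null (fun z hz => hz.2.2) hvolH) ?_ ?_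
  · exact (inBaker_cellRep_three (p3 ρ) (totalDegree_p3_le ρ) q).congr
      (KZ.of_sub_of_mem_relations_of_eqOn rfl fun z _ => by
        rw [KZ.IntegralRep.integrand_restrict, cellRep_integrand]; rfl)
  · exact ConicDescent.InBaker.of_mem_relations
      (KZ.of_mem_relations_of_volume_eq_zero _ (measure_mono_null (fun z hz => hz.2) hvolH))

/-- **The planar factor `tRep ρ q = [T(ρ), q·(ρ − (1+y)² − y₁²)]` is `InBaker`.**
[KontsevichZagier2001 §1.2; Baker1975 Thm 2.1] -/
theorem inBaker_tRep (q : ℚ) (h2 : ρ ≤ 2) : InBaker (KZ.of (tRep ρ q h2)) :=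
  inBaker_congr' (inBaker_band3 q h2) (of_band3_sub_of_tRep_mem_relations q h2)

/-! #### 2. The cap is `InPiBaker` -/

/-- The unit quarter disc `[(0,1)² ∩ {u₀² + u₁² < 1}, 1]` is `[hq,1]` modulo relations (parts 80, 94).
[KontsevichZagier2001 §1.2] -/
theorem of_disc_sub_of_hqRep_mem_relations :
    KZ.of (cellRep discPoly 1) - KZ.of (hqRep 1) ∈ KZ.relations := by
  have := add_mem (of_disc_sub_of_arcRep_mem_relations 1) (of_arcRep_sub_of_hqRep_mem_relations 1)
  rwa [sub_add_sub_cancel] at this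

/-- **The chart source `tRep × (quarter disc)` is `InPiBaker`** (`[N]·[hq,1]` with `N ≡ B`, and the
disc is `[hq,1]`; products preserve relations). [KontsevichZagier2001 §1.2, §4.1] -/
theorem inPiBaker_srcRep (q : ℚ) (h2 : ρ ≤ 2) : InPiBaker (KZ.of (srcRep ρ q h2)) := by
  obtain ⟨y, hy, hrel⟩ := inBaker_tRep q h2
  have h1 : InPiBaker (KZ.of (tRep ρ q h2) * KZ.of (hqRep 1)) := PiB.InPiBaker.of_mul_sub_mem hy hrel
  have h2' : InPiBaker (KZ.of (tRep ρ q h2) * KZ.of (cellRep discPoly 1)) :=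
    h1.congr (by rw [← mul_sub]; exact KZ.of_mul_mem_relations _ of_disc_sub_of_hqRep_mem_relations)
  rwa [KZ.of_mul_of] at h2'

/-- **The cap `[K_0(ρ), q]` is `InPiBaker`** (the `2+2` chart of part 105). [KontsevichZagier2001 §1.2] -/
theorem inPiBaker_capRep_zero (q : ℚ) (h2 : ρ ≤ 2) : InPiBaker (KZ.of (capRep ρ q h2 0)) :=
  inPiBaker_congr' (inPiBaker_srcRep q h2) (of_srcRep_sub_of_capRep_mem_relations q h2)

/-- Every cap `[K_i(ρ), q]` is `InPiBaker` (swap `(0 i)`). [KontsevichZagier2001 §1.2] -/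
theorem inPiBaker_capRep (q : ℚ) (h2 : ρ ≤ 2) (i : Fin 4) : InPiBaker (KZ.of (capRep ρ q h2 i)) :=
  inPiBaker_congr' (inPiBaker_capRep_zero q h2) (of_capRep_zero_sub_of_capRep_mem_relations q h2 i)

/-! #### 3. Peeling the caps -/

/-- The orthant ball `[B_0(ρ), q] ≡ [unit ball cell, ρ²q]` is `InPiBaker` (`0 < ρ ≤ 2`).
[KontsevichZagier2001 §1.2, §4.1] -/
theorem inPiBaker_bRep_zero (hρ : 0 < ρ) (h2 : ρ ≤ 2) (q : ℚ) : InPiBaker (KZ.of (bRep ρ q h2 0)) :=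
  inPiBaker_congr' (PiB.InPiBaker.of_ball4_cell (ρ ^ 2 * q))
    (of_ball4_cell_sub_of_bRep_zero_mem_relations hρ h2 q)

/-- One peeling step: `[B_{i+1}] ≡ [B_i] − [K_i]`. [KontsevichZagier2001 §1.2 rule (1)] -/
theorem inPiBaker_bRep_succ (q : ℚ) (h2 : ρ ≤ 2) (i : Fin 4) (hB : InPiBaker (KZ.of (bRep ρ q h2 i))) :
    InPiBaker (KZ.of (bRep ρ q h2 ((i : ℕ) + 1))) :=
  inPiBaker_congr' (hB.sub (inPiBaker_capRep q h2 i))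
    (by rw [sub_right_comm]; exact of_bRep_sub_sub_mem_relations q h2 i)

/-- `[B_4(ρ), q]` is `InPiBaker` (`0 < ρ ≤ 2`). [KontsevichZagier2001 §1.2] -/
theorem inPiBaker_bRep_four (hρ : 0 < ρ) (h2 : ρ ≤ 2) (q : ℚ) : InPiBaker (KZ.of (bRep ρ q h2 4)) :=
  inPiBaker_bRep_succ q h2 3 (inPiBaker_bRep_succ q h2 2 (inPiBaker_bRep_succ q h2 1
    (inPiBaker_bRep_succ q h2 0 (inPiBaker_bRep_zero hρ h2 q))))

/-! #### 4. THE SPECIMEN -/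

/-- **THE SPECIMEN (gen 13): the face-cut ball cell `[(0,1)⁴ ∩ {Σxᵢ² < ρ}, q]` is `InPiBaker`** for
every rational `ρ ≤ 2` (empty for `ρ ≤ 0`). [KontsevichZagier2001 §1.2, §4.1; Baker1975 Thm 2.1] -/
theorem inPiBaker_cutBall (h2 : ρ ≤ 2) (q : ℚ) : InPiBaker (KZ.of (cellRep (cutPoly ρ) q)) := by
  by_cases hρ : 0 < ρ
  · exact inPiBaker_congr' (inPiBaker_bRep_four hρ h2 q) (of_bRep_four_sub_of_cellRep_mem_relations q h2)
  · refine PiB.InPiBaker.of_mem_relations (KZ.of_mem_relations_of_volume_eq_zero _ ?_)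
    have hρ' : (ρ : ℝ) ≤ 0 := by exact_mod_cast not_lt.1 hρ
    have he : (cellRep (cutPoly ρ) q).domain = ∅ := by
      rw [cellRep_domain]
      refine Set.eq_empty_iff_forall_notMem.2 fun x hx => ?_
      obtain ⟨-, hP⟩ := hx
      rw [aeval_cutPoly] at hP
      nlinarith [sq_nonneg (x 0), sq_nonneg (x 1), sq_nonneg (x 2), sq_nonneg (x 3)]
    rw [he]
    exact measure_empty

/-- **`cutPoly ρ` (`ρ ≤ 2`) is in the `[hq]·B`-class.** [KontsevichZagier2001 §1.2, §4.1] -/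
theorem piBDescentAt_cutBall (h2 : ρ ≤ 2) : QuadricDescentAt piBGens (cutPoly ρ) :=
  piBDescentAt_of_inPiBaker (inPiBaker_cutBall h2)

/-- Permuted reflections of face-cut balls (the cut ball at any vertex of the cube) are in the
`[hq]·B`-class. [KontsevichZagier2001 §1.2 rule (2)] -/
theorem piBDescentAt_cutBall_rename_reflect (h2 : ρ ≤ 2) (σ : Equiv.Perm (Fin 4)) (j : Fin 4) :
    QuadricDescentAt piBGens (rename σ (bind₁ (KZ.reflectSubst j) (cutPoly ρ))) :=
  descentAt_rename_reflect σ j (totalDegree_cutPoly_le ρ) (piBDescentAt_cutBall h2)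

/-- **Conjecture 1 (kernel form) for families of face-cut balls, UNCONDITIONALLY**: every vanishing
`ℤ`-combination of constant-weight cells `[C_{ρᵢ}, qᵢ]` (`ρᵢ ≤ 2`; `ρᵢ = 1` is the unit ball) is a
Kontsevich–Zagier relation. [KontsevichZagier2001 §1.2, §4.1; Baker1975 Thm 2.1; this node] -/
theorem sum_mem_relations_cutBalls (k : ℕ) (ρ : Fin k → ℚ) (h2 : ∀ i, ρ i ≤ 2) (q : Fin k → ℚ)
    (r : Fin k → KZ.IntegralRep 4) (c : Fin k → ℤ)
    (hr : ∀ i, (r i).domain = {x | (∀ j, 0 < x j ∧ x j < 1) ∧ 0 < MvPolynomial.aeval x (cutPoly (ρ i))} ∧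
      ∀ x ∈ (r i).domain, (r i).integrand x = (q i : ℝ))
    (hv : KZ.eval (∑ i, c i • KZ.of (r i)) = 0) : (∑ i, c i • KZ.of (r i)) ∈ KZ.relations :=
  sum_mem_relations_piB k (fun _ => 4) (fun i => cutPoly (ρ i)) q r c
    (fun i => piBDescentAt_cutBall (h2 i)) hr (fun i => totalDegree_cutPoly_le (ρ i)) hv

/-! #### 5. The affine-`π` class: inventory and the one oracle -/

/-- Face-cut balls are in the `A`-class. [this node] -/
theorem affDescentAt_cutBall (h2 : ρ ≤ 2) : QuadricDescentAt affGens (cutPoly ρ) :=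
  affDescentAt_of_piBDescentAt (piBDescentAt_cutBall h2)

/-- The unit ball is in the `A`-class. [this node] -/
theorem affDescentAt_ball4 : QuadricDescentAt affGens ball4Poly :=
  affDescentAt_of_piBDescentAt PiB.piBDescentAt_ball4

/-- The solid paraboloid is in the `A`-class. [this node] -/
theorem affDescentAt_parab4 : QuadricDescentAt affGens parab4Poly :=
  affDescentAt_of_piDescentAt piDescentAt_parab4

/-- The Lorentzian cone is in the `A`-class. [this node] -/
theorem affDescentAt_cone4 : QuadricDescentAt affGens cone4Poly :=
  affDescentAt_of_piDescentAt piDescentAt_cone4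

/-- Every quadric of dimension `≤ 3` is in the `A`-class (PROVED support `QuadricBakerDescent`).
[Baker1975 Thm 2.1; this node] -/
theorem affDescentAt_of_le_three {d : ℕ} (hd : d ≤ 3) (P : MvPolynomial (Fin d) ℚ) :
    QuadricDescentAt affGens P :=
  affDescentAt_of_bakerDescentAt
    ((bakerDescentAt_iff P).1 (quadricBakerDescent_iff.1 quadricBakerDescent_holds d hd P))

/-- **The mixed families, given the ONE oracle `AffinePiKernel`**: every vanishing `ℤ`-combination of
constant-weight quadric cells whose quadrics are face-cut balls (`ρ ≤ 2`), unit balls, paraboloids,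
cones (any vertex / axis) or of dimension `≤ 3` is a Kontsevich–Zagier relation.
[KontsevichZagier2001 §1.2; Baker1975 Thm 2.1; this node] -/
theorem sum_mem_relations_aff_inventory (hA : AffinePiKernel) (k : ℕ) (d : Fin k → ℕ)
    (P : (i : Fin k) → MvPolynomial (Fin (d i)) ℚ) (q : Fin k → ℚ)
    (r : (i : Fin k) → KZ.IntegralRep (d i)) (c : Fin k → ℤ) (hW : ∀ i, QuadricDescentAt affGens (P i))
    (hr : ∀ i, (r i).domain = {x | (∀ j, 0 < x j ∧ x j < 1) ∧ 0 < MvPolynomial.aeval x (P i)} ∧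
      ∀ x ∈ (r i).domain, (r i).integrand x = (q i : ℝ))
    (hdeg : ∀ i, (P i).totalDegree ≤ 2) (hv : KZ.eval (∑ i, c i • KZ.of (r i)) = 0) :
    (∑ i, c i • KZ.of (r i)) ∈ KZ.relations :=
  sum_mem_relations_aff hA k d P q r c hW hr hdeg hv

end Summit.KontsevichZagierPeriods.RootDecompWalshStrata.CutBall4

end
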